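import Literature.Computability.FineGrained.NSETHNonReducibilityAPSPValid
import Literature.Computability.Cryptography.WordRAMInline4
import Literature.Computability.Cryptography.APSPWordRAM
import Literature.Computability.Cryptography.FGComplexityProofs
import Literature.Computability.FineGrained.CliqueETHReductionProgram
import HarnessLib

/-!
# NSETH non-reducibility to APSP — proofs: the in-RAM elimination of the APSP oracle

Proof file (D-0014 sibling) of `Literature.Computability.FineGrained.NSETHNonReducibilityAPSP` /
`…NSETHNonReducibilityAPSPValid`, the decomposition of the named fact
`not_fgReducible_cnfSATWithSize_apsp_of_nseth` (**fine-grained.S20** for APSP, `SETHHardness.lean`;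
Carmosino–Gao–Impagliazzo–Mihajlin–Paturi–Schneider, ITCS 2016, Thm. 2–3). Those files reduce the
target to ONE hypothesis in two alternative forms; this file PROVES the word-RAM form — hypothesis
`helim` of `not_fgReducible_cnfSATWithSize_apsp_of_nseth_of_validOracleElim` — and thereby reduces the
target to the EXISTING named fact of the 3SUM sibling, the change of machine model
`sparseKSATInExpTime_of_cnfSATInThreeSumOracleRAMTime` (`NSETHNonReducibility.lean`):

* `cnfSATInThreeSumOracleRAMTime_of_valid` / `validOracleElim_holds`: an APSP-oracle word-RAM
  program deciding `CNFSATWithSize c` in `⌊C 2^{ρ n} + C⌋` steps all of whose queries encode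
  `APSP c'` instances (`CNFSATInAPSPOracleRAMTimeValid c c' ρ`) yields, for every `η > 0`, a program
  of exponent `ρ + η` that ignores its oracle (hence a `threeSumOracle` program,
  `CNFSATInThreeSumOracleRAMTime c (ρ + η)`). The program is the simulating machine with wipes
  `WordRAM.Inline.SIM'` of `…WordRAMInline4` — the inline oracle simulator of V. Vassilevska
  Williams' transfer argument (ICM 2018, §2, remark after Def. 2.1) without the hypothesis that the
  running time fits in a word — run on the reduction `M` with the verified cubic APSP program of
  `APSP_inTimeO_cube_holds` (`…APSPWordRAM`) inlined. Bookkeeping: the canonical oracle never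
  answers more words than asked (`length_apspOracle_le`), so along the run every query has length
  `≤ V = 2^{c₁ w} - 1` (`WordRAM.run_queries_length_le`, `w = inputWidth (encodeCNFWords φ)`);
  each query is an `APSP c'` instance on `m ≤ V` nodes, answered inline in `≤ ⌈C_B⌉ (V³ + 1)` steps
  with an answer of length `≤ V`; there are at most `t` queries; with the word-size constant of
  `FGComplexityProofs.sim_numerics` the total cost is `≤ (t + 1) · A · (2^w)^E`
  (`simCost'_le_linear`) and `2^w ≤ 8 (n+1)^{c+1}` (`two_pow_inputWidth_encodeCNFWords_le`), so
  `(t + 1) · poly(n) ≤ C' 2^{(ρ+η) n}` by `exists_pow_le_two_rpow`.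
* `not_fgReducible_cnfSATWithSize_apsp_of_nseth_of_threeSumBridge`: hence the 3SUM sibling's
  machine-model fact ALONE implies fine-grained.S20 for APSP; once that fact is discharged,
  `not_fgReducible_cnfSATWithSize_apsp_of_nseth_holds` is this theorem applied to its `_holds`.

## References

* M. L. Carmosino, J. Gao, R. Impagliazzo, I. Mihajlin, R. Paturi, S. Schneider, ITCS 2016, §3
  Lemma 1 ("run the reduction and simulate the oracle calls"), §5 Thm. 2–3. [`CarmosinoEtAlITCS2016`]
* V. Vassilevska Williams, Proc. ICM 2018, §2, Def. 2.1 and the remark following it.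
  [`VassilevskaWilliamsICM2018`]
-/


namespace Literature.Computability.Cryptography.WordRAM

open StateTransition

/-- **Query lengths stay bounded under an oracle whose answers are never longer than its
questions.** Along a run from a `V`-bounded memory (`V ≥ 2 ^ w - 1`, `V ≥ maxConst P`, `V ≥ 1`)
whose logged queries have length `≤ V`, every logged query keeps length `≤ V` and the memory stays
`V`-bounded: a new query has length `ql.read mem ≤ V`, and the answer written back is no longer. [folklore] -/
theorem run_queries_length_le {P : Program} {w : ℕ} {O : List ℕ → List ℕ} {ρ : ℕ → ℕ} {V : ℕ}
    (hw : 2 ^ w - 1 ≤ V) (h1 : 1 ≤ V) (hP : Program.maxConst P ≤ V)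
    (hO : ∀ q, (O q).length ≤ q.length) :
    ∀ (n : ℕ) {c c' : Cfg}, MemLE V c.mem → (∀ q ∈ c.queries, q.length ≤ V) →
      run P w O ρ n c = some c' → (∀ q ∈ c'.queries, q.length ≤ V) ∧ MemLE V c'.mem
  | 0, c, c', hc, hq, h => by
      simp only [run_zero, Option.some.injEq] at h; subst h; exact ⟨hq, hc⟩
  | n + 1, c, c', hc, hq, h => by
      rw [run_add, Option.bind_eq_some_iff] at h
      obtain ⟨d, hd, hlast⟩ := h
      rw [run_one] at hlast
      obtain ⟨hqd, hmd⟩ := run_queries_length_le hw h1 hP hO n hc hq hd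
      have hq' : ∀ q ∈ c'.queries, q.length ≤ V := by
        rcases step_queries hlast with h | ⟨i, qa, ql, aa, hpc, hI, h⟩
        · rw [h]; exact hqd
        · rw [h]
          intro q hq
          rcases List.mem_append.1 hq with hq | hq
          · exact hqd q hq
          · rw [List.mem_singleton.1 hq, readSeg_length]
            have hIc : (Instr.query qa ql aa).maxConst ≤ V :=
              le_trans (Instr.maxConst_le_of_getElem? hI) hP
            simp only [Instr.maxConst, max_le_iff] at hIc
            exact Operand.read_le hmd ql hIc.2.1
      exact ⟨hq', step_memLE_of_queries hw h1 hP hmd hlast fun q hq => (hO q).trans (hq' q hq)⟩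

end Literature.Computability.Cryptography.WordRAM

namespace Literature.Computability.FineGrained

open Cryptography Cryptography.WordRAM Complexity

/-! ### Bounds on the encoding of `CNFSATWithSize c` instances -/

/-- A single clause is no longer than the size of the CNF. [folklore] -/
theorem length_le_size_of_mem_cnf {φ : CNF ℕ} {cl : Clause ℕ} (hc : cl ∈ φ) : cl.length ≤ φ.size := by
  unfold CNF.size
  exact List.single_le_sum (fun _ _ => Nat.zero_le _) _ (List.mem_map.2 ⟨cl, hc, rfl⟩)

/-- Every word of `encodeCNFWords φ` is at most `numClauses + size + 2 · numVars`. [folklore] -/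
theorem le_of_mem_encodeCNFWords (φ : CNF ℕ) {v : ℕ} (hv : v ∈ encodeCNFWords φ) :
    v ≤ φ.numClauses + φ.size + 2 * φ.numVars := by
  rw [encodeCNFWords_eq] at hv
  simp only [List.mem_cons, clauseWords, List.mem_flatMap, List.mem_map] at hv
  rcases hv with rfl | rfl | ⟨cl, hcl, hv⟩
  · omega
  · omega
  · rcases hv with rfl | ⟨l, hl, rfl⟩
    · have := length_le_size_of_mem_cnf hcl; omega
    · have h1 := CliqueRed.lt_numVars_of_mem hcl hl
      have h2 : (l.2.toNat : ℕ) ≤ 1 := Bool.toNat_le l.2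
      unfold litCode; omega

/-- `2 ^ inputWidth x ≤ 2 · B` whenever the length and all entries of `x` are `≤ B` and `1 ≤ B`
(`Nat.size m` is the least `s` with `m < 2 ^ s`). [folklore] -/
theorem two_pow_inputWidth_le {x : List ℕ} {B : ℕ} (h1 : 1 ≤ B) (hlen : x.length ≤ B)
    (hent : ∀ v ∈ x, v ≤ B) : 2 ^ inputWidth x ≤ 2 * B := by
  unfold inputWidth
  set m := max x.length (x.foldr max 1) with hm
  have hmB : m ≤ B := max_le hlen (foldr_max_one_le h1 hent)
  have hm1 : 1 ≤ m := le_trans (by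
    suffices h : ∀ l : List ℕ, 1 ≤ l.foldr max 1 from h x
    intro l; induction l with
    | nil => simp
    | cons a l ih => exact le_trans ih (by simp)) (le_max_right _ _)
  -- `2 ^ (size m - 1) ≤ m`
  have hs : 2 ^ Nat.size m ≤ 2 * m := by
    have hpos : 0 < Nat.size m := Nat.size_pos.2 hm1
    have h := Nat.lt_size.1 (show Nat.size m - 1 < Nat.size m by omega)
    rw [show Nat.size m = (Nat.size m - 1) + 1 by omega, Nat.pow_succ]
    omega
  omega

end Literature.Computability.FineGrained

namespace Literature.Computability.FineGrained

open Cryptography Cryptography.WordRAM Complexity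

/-! ### The cost of the simulating machine, as a polynomial times the time of the reduction -/

/-- Arithmetic of the cost bound: with `U` dominating `L, V, V³ + 1, Q, size W` and the per-query
data bounded accordingly, `simCost'` is at most `(t + 1) · (A · U)` for
`A = 1000 + 40 k' + 76 c_B`. [folklore] -/
theorem simCost'_le_linear {L W t ℓ V U k' cB : ℕ} {qs : List (List ℕ)} {O : List ℕ → List ℕ}
    {s : List ℕ → ℕ} (hU1 : 1 ≤ U) (hLU : L ≤ U) (hVU : V ≤ U) (hV3U : V ^ 3 + 1 ≤ U)
    (hQU : Inline.Qv W ≤ U) (hsW : Nat.size W ≤ k' * U) (hℓ : ℓ ≤ V) (hlen : qs.length ≤ t)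
    (hq : ∀ q ∈ qs, q.length ≤ V ∧ (O q).length ≤ V ∧ s q ≤ cB * (V ^ 3 + 1)) :
    Inline.simCost' L W t ((qs.map (Inline.charge' W O s)).sum) ℓ ≤
      (t + 1) * ((1000 + 40 * k' + 76 * cB) * U) := by
  -- per-query charge
  have hcharge : ∀ q ∈ qs, Inline.charge' W O s q ≤ (200 + 20 * k' + 38 * cB) * U := by
    intro q hqm
    obtain ⟨h1, h2, h3⟩ := hq q hqm
    simp only [Inline.charge', Inline.wpreCost, Inline.qbCost]
    have e1 : 38 * s q ≤ 38 * cB * U := by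
      have := Nat.mul_le_mul_left 38 (h3.trans (Nat.mul_le_mul_left cB hV3U)); 
      simpa [Nat.mul_assoc] using this
    nlinarith
  have hsum : (qs.map (Inline.charge' W O s)).sum ≤ t * ((200 + 20 * k' + 38 * cB) * U) := by
    have h := List.sum_le_card_nsmul (qs.map (Inline.charge' W O s)) ((200 + 20 * k' + 38 * cB) * U)
      (fun x hx => by
        obtain ⟨q, hqm, rfl⟩ := List.mem_map.1 hx
        exact hcharge q hqm)
    simp only [List.length_map, smul_eq_mul] at h
    exact h.trans (Nat.mul_le_mul_right _ hlen)
  have hcs : cstep = 38 := rfl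
  simp only [Inline.simCost', Inline.proCost, widthCost, Inline.epiCost, hcs]
  set S := (qs.map (Inline.charge' W O s)).sum with hS
  have h1 : 11 * L + (9 * L + 20 * Nat.size W + 15) + 260 + 38 * t + S + (6 * ℓ + 340) ≤
      (641 + 20 * k') * U + 38 * t + t * ((200 + 20 * k' + 38 * cB) * U) := by
    have hℓU : ℓ ≤ U := hℓ.trans hVU
    nlinarith [hsum, hLU, hsW, hℓU, hU1]
  have e : (t + 1) * ((1000 + 40 * k' + 76 * cB) * U) =
      t * ((200 + 20 * k' + 38 * cB) * U) + t * ((800 + 20 * k' + 38 * cB) * U) +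
        (1000 + 40 * k' + 76 * cB) * U := by ring
  rw [e]
  have f1 : 38 * t ≤ t * ((800 + 20 * k' + 38 * cB) * U) := by
    have : 38 ≤ (800 + 20 * k' + 38 * cB) * U := by nlinarith [hU1]
    calc 38 * t = t * 38 := by ring
      _ ≤ t * ((800 + 20 * k' + 38 * cB) * U) := Nat.mul_le_mul_left t this
  have f2 : (641 + 20 * k') * U ≤ (1000 + 40 * k' + 76 * cB) * U :=
    Nat.mul_le_mul_right U (by omega)
  linarith

end Literature.Computability.FineGrained

namespace Literature.Computability.FineGrained

open Cryptography Cryptography.WordRAM Complexity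

/-! ### Route (b): eliminating the APSP oracle inside the word RAM -/

/-- Floors of affine cubic bounds by ceilings: `⌊C a³ + C⌋₊ ≤ ⌈max C 0⌉₊ (a³ + 1)` for `a : ℕ`. [folklore] -/
theorem floor_affine_cube_le_ceil_mul (C : ℝ) (a : ℕ) :
    ⌊C * (a : ℝ) ^ 3 + C⌋₊ ≤ ⌈max C 0⌉₊ * (a ^ 3 + 1) := by
  have h0 : (0 : ℝ) ≤ max C 0 := le_max_right _ _
  have h1 : C * (a : ℝ) ^ 3 + C ≤ (⌈max C 0⌉₊ : ℝ) * ((a : ℝ) ^ 3 + 1) := by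
    have hC : C ≤ max C 0 := le_max_left _ _
    have hc : max C 0 ≤ (⌈max C 0⌉₊ : ℝ) := Nat.le_ceil _
    have ha : (0 : ℝ) ≤ (a : ℝ) ^ 3 := by positivity
    nlinarith
  have h2 : ((⌊C * (a : ℝ) ^ 3 + C⌋₊ : ℕ) : ℝ) ≤ ((⌈max C 0⌉₊ * (a ^ 3 + 1) : ℕ) : ℝ) := by
    rcases lt_or_ge (C * (a : ℝ) ^ 3 + C) 0 with hneg | hnn
    · rw [Nat.floor_of_nonpos hneg.le]; exact_mod_cast Nat.zero_le _
    · push_cast; exact (Nat.floor_le hnn).trans h1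
  exact_mod_cast h2

/-- The encoding of an instance of `CNFSATWithSize c`: length and entries at most
`B = (n+1)ᶜ + 2n + 2`, hence `2 ^ inputWidth ≤ 2B ≤ 8 (n+1)^{c+1}`. [folklore] -/
theorem two_pow_inputWidth_encodeCNFWords_le {c : ℕ} {φ : CNF ℕ}
    (hφ : φ.numClauses + φ.size ≤ (φ.numVars + 1) ^ c) :
    2 ^ inputWidth (encodeCNFWords φ) ≤ 8 * (φ.numVars + 1) ^ (c + 1) := by
  set B := (φ.numVars + 1) ^ c + 2 * φ.numVars + 2 with hB
  have hlen : (encodeCNFWords φ).length ≤ B := by rw [length_encodeCNFWords_eq]; omega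
  have hent : ∀ v ∈ encodeCNFWords φ, v ≤ B := fun v hv => by
    have := le_of_mem_encodeCNFWords φ hv; omega
  have h1 := two_pow_inputWidth_le (by omega : 1 ≤ B) hlen hent
  have hp : (φ.numVars + 1) ^ c ≤ (φ.numVars + 1) ^ (c + 1) :=
    Nat.pow_le_pow_right (by omega) (by omega)
  have hp1 : φ.numVars + 1 ≤ (φ.numVars + 1) ^ (c + 1) := by
    calc φ.numVars + 1 = (φ.numVars + 1) ^ 1 := (pow_one _).symm
      _ ≤ (φ.numVars + 1) ^ (c + 1) := Nat.pow_le_pow_right (by omega) (by omega)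
  omega

set_option maxHeartbeats 800000 in
/-- **Route (b), the word-RAM half (proved): an APSP-oracle program for `CNFSATWithSize c` all of
whose queries are `APSP c'` instances is, for every `η > 0`, a 3SUM-oracle (indeed oracle-ignoring)
program of exponent `ρ + η`.** The program is the simulating machine with wipes `Inline.SIM'`
(`…WordRAMInline4`) of the given reduction `M` with the verified cubic APSP program of
`APSP_inTimeO_cube_holds` inlined: every query is an `APSP c'` instance (`CNFSATInAPSPOracleRAMTimeValid`)
of length `≤ V = 2^{c₁ w} - 1 = poly(n)` (`run_queries_length_le`, the canonical oracle never
answering more words than asked), answered in `O(V³)` inline steps, and there are at most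
`t = ⌊C 2^{ρ n} + C⌋` of them; with the word-size constant of `FGComplexityProofs.sim_numerics` the
whole run costs `(t + 1) · poly(n) ≤ C' 2^{(ρ+η) n}` steps (`exists_pow_le_two_rpow`). This is the
hypothesis `helim` of `not_fgReducible_cnfSATWithSize_apsp_of_nseth_of_validOracleElim`.
(VVW ICM 2018, §2, remark after Def. 2.1; Carmosino et al. 2016, §3 Lemma 1.)
[cite: CarmosinoEtAlITCS2016, §3 Lemma 1] -/
theorem cnfSATInThreeSumOracleRAMTime_of_valid {c c' : ℕ} {ρ : ℝ} (hρ : 0 ≤ ρ)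
    (h : CNFSATInAPSPOracleRAMTimeValid c c' ρ) {η : ℝ} (hη : 0 < η) :
    CNFSATInThreeSumOracleRAMTime c (ρ + η) := by
  obtain ⟨M, k, C, hdet, hM⟩ := h
  -- the APSP algorithm and the oracle it computes
  obtain ⟨CB, MB, kB, hBdet, hBof, hMBrun⟩ := APSP_inTimeO_cube_holds c'
  obtain ⟨OB, s, hOB, hs⟩ := exists_oracle_of_algorithm (B := APSP c') hMBrun
  -- constants
  obtain ⟨m, hm⟩ : ∃ m, m = Program.maxConst M := ⟨_, rfl⟩
  obtain ⟨mB, hmB⟩ : ∃ mB, mB = Program.maxConst MB := ⟨_, rfl⟩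
  obtain ⟨c₁, hc₁⟩ : ∃ c₁, c₁ = 0 + 0 + k + m + 2 := ⟨_, rfl⟩
  obtain ⟨k', hk'⟩ : ∃ k', k' = kB * c₁ + mB + c₁ + 0 + 11 := ⟨_, rfl⟩
  obtain ⟨cBn, hcBn⟩ : ∃ cBn, cBn = ⌈max CB 0⌉₊ := ⟨_, rfl⟩
  obtain ⟨E, hE⟩ : ∃ E, E = 3 * c₁ + k' := ⟨_, rfl⟩
  obtain ⟨A, hA⟩ : ∃ A, A = 1000 + 40 * k' + 76 * cBn := ⟨_, rfl⟩
  obtain ⟨Cp, hCp0, hCp⟩ := exists_pow_le_two_rpow ((c + 1) * E) hη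
  obtain ⟨Cplus, hCplus⟩ : ∃ Cplus : ℝ, Cplus = max C 0 := ⟨_, rfl⟩
  have hCplus0 : 0 ≤ Cplus := by rw [hCplus]; exact le_max_right _ _
  have hCC : C ≤ Cplus := by rw [hCplus]; exact le_max_left _ _
  obtain ⟨C', hC'⟩ : ∃ C' : ℝ, C' = 2 * A * 8 ^ E * Cp * (Cplus + 1) := ⟨_, rfl⟩
  have hC'0 : 0 ≤ C' := by rw [hC']; positivity
  refine ⟨Inline.SIM' M k MB kB, k', C', Inline.SIM'_isDeterministic M k MB kB, fun φ hφ => ?_⟩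
  obtain ⟨cM, hrun, hgood, hvalid⟩ := hM φ hφ
  -- abbreviations
  set w : ℕ := inputWidth (encodeCNFWords φ) with hw
  obtain ⟨t, ht⟩ : ∃ t, t = ⌊C * (2 : ℝ) ^ (ρ * (φ.numVars : ℝ)) + C⌋₊ := ⟨_, rfl⟩
  have hrun' : HaltsWithin M (k * w) apspOracle zeroCoins (encodeCNFWords φ) t cM := by
    rw [ht]; exact hrun
  have hw1 : 1 ≤ w := inputWidth_pos _
  have hLw : (encodeCNFWords φ).length < 2 ^ w := length_lt_two_pow_inputWidth _
  obtain ⟨hwW, hkW, hL83, hmV, hV1, hwsV, hVQ, hkBV, hVB, hVBQ, -, -⟩ :=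
    sim_numerics (G := 0) (Co := 0) (t := 0) (k := k) (m := m) (kB := kB) (mB := mB) hw1
      (Nat.zero_le _) hLw hc₁ hk'
  obtain ⟨V, hV⟩ : ∃ V, V = 2 ^ (c₁ * w) - 1 := ⟨_, rfl⟩
  rw [← hV] at hmV hV1 hwsV hVQ hkBV hVB
  rw [hm] at hmV
  -- query lengths and the value bound
  obtain ⟨nM, hnM, hrunM, -⟩ := hrun'.exists_run
  obtain ⟨hqV, hmemM⟩ := run_queries_length_le (ρ := zeroCoins) hwsV hV1 hmV length_apspOracle_le nM
    (init_memLE _ _ hwsV) (by simp) hrunM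
  have hO : ∀ q ∈ cM.queries, (apspOracle q).length ≤ V :=
    fun q hq => (length_apspOracle_le q).trans (hqV q hq)
  -- the inline runs answer the queries
  have hMB : ∀ q ∈ cM.queries, ∃ cB, HaltsWithin MB (kB * inputWidth q) noOracle zeroCoins q (s q) cB ∧
      readOut cB.mem = apspOracle q := by
    intro q hq
    obtain ⟨y, rfl⟩ := hvalid q hq
    obtain ⟨-, cB, hcB, hout⟩ := hs y
    refine ⟨cB, hcB, ?_⟩
    have h1 := hOB y
    rw [APSP_good, Set.mem_singleton_iff] at h1
    rw [hout, h1]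
    exact (apspOracle_encodeMatrixWithTop y.1.2).symm
  -- per-query data
  have hq : ∀ q ∈ cM.queries, q.length ≤ V ∧ (apspOracle q).length ≤ V ∧ s q ≤ cBn * (V ^ 3 + 1) := by
    intro q hqm
    refine ⟨hqV q hqm, hO q hqm, ?_⟩
    obtain ⟨y, hy⟩ := hvalid q hqm
    obtain ⟨hsy, -⟩ := hs y
    have hsy' : s ((APSP c').encode y) ≤ ⌊CB * ((y.1.1 : ℕ) : ℝ) ^ 3 + CB⌋₊ := hsy
    have hlen : ((APSP c').encode y).length = y.1.1 ^ 2 + 1 := encodeMatrixWithTop_length y.1.2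
    have hny : y.1.1 ≤ V := by
      have := hqV q hqm; rw [hy, hlen] at this; nlinarith
    rw [hy]
    refine hsy'.trans ((floor_affine_cube_le_ceil_mul CB y.1.1).trans ?_)
    rw [hcBn]
    exact Nat.mul_le_mul_left _ (by have := Nat.pow_le_pow_left hny 3; omega)
  -- the cost, as a natural number
  have hlen : cM.queries.length ≤ t := by simpa using (run_queries_length nM hrunM).trans (by simpa using hnM)
  have hℓ : (readOut cM.mem).length ≤ V := by rw [readOut_length]; exact hmemM 0
  obtain ⟨U, hU⟩ : ∃ U, U = (2 ^ w) ^ E := ⟨_, rfl⟩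
  have hU1 : 1 ≤ U := by rw [hU]; exact Nat.one_le_pow _ _ (Nat.one_le_two_pow)
  have h2wU : 2 ^ w ≤ U := by
    calc 2 ^ w = (2 ^ w) ^ 1 := (pow_one _).symm
      _ ≤ (2 ^ w) ^ E := Nat.pow_le_pow_right (Nat.one_le_two_pow) (by omega)
      _ = U := hU.symm
  have hE1 : c₁ * w ≤ w * E := by
    calc c₁ * w ≤ (3 * c₁ + k') * w := Nat.mul_le_mul_right w (by omega)
      _ = w * E := by rw [hE, Nat.mul_comm]
  have hE3 : c₁ * w * 3 ≤ w * E := by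
    calc c₁ * w * 3 = (3 * c₁) * w := by ring
      _ ≤ (3 * c₁ + k') * w := Nat.mul_le_mul_right w (by omega)
      _ = w * E := by rw [hE, Nat.mul_comm]
  have hEk : k' * w ≤ w * E := by
    calc k' * w ≤ (3 * c₁ + k') * w := Nat.mul_le_mul_right w (by omega)
      _ = w * E := by rw [hE, Nat.mul_comm]
  have hVU : V ≤ U := by
    have : 2 ^ (c₁ * w) ≤ U := by
      rw [hU, ← Nat.pow_mul]; exact Nat.pow_le_pow_right (by omega) hE1
    omega
  have hV3U : V ^ 3 + 1 ≤ U := by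
    have h1 : V ^ 3 + 1 ≤ (V + 1) ^ 3 := by
      have : (V + 1) ^ 3 = V ^ 3 + 3 * V ^ 2 + 3 * V + 1 := by ring
      rw [this]; omega
    have h2 : V + 1 = 2 ^ (c₁ * w) := by have : 1 ≤ 2 ^ (c₁ * w) := Nat.one_le_two_pow; omega
    have h3 : (2 ^ (c₁ * w)) ^ 3 ≤ U := by
      rw [hU, ← Nat.pow_mul, ← Nat.pow_mul]; exact Nat.pow_le_pow_right (by omega) hE3
    rw [h2] at h1; exact h1.trans h3
  have hQU : Inline.Qv (k' * w) ≤ U := by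
    have h1 : Inline.Qv (k' * w) ≤ 2 ^ (k' * w) := Nat.pow_le_pow_right (by omega) (by omega)
    have h2 : 2 ^ (k' * w) ≤ U := by
      rw [hU, ← Nat.pow_mul]; exact Nat.pow_le_pow_right (by omega) hEk
    exact h1.trans h2
  have hsW : Nat.size (k' * w) ≤ k' * U := by
    have h1 : Nat.size (k' * w) ≤ k' * w := Nat.size_le.2 (Nat.lt_two_pow_self)
    have h2 : w ≤ U := (Nat.lt_two_pow_self).le.trans h2wU
    exact h1.trans (Nat.mul_le_mul_left _ h2)
  have hcost := simCost'_le_linear (O := apspOracle) (s := s) (L := (encodeCNFWords φ).length)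
    (W := k' * w) hU1 (hLw.le.trans h2wU) hVU hV3U hQU hsW hℓ hlen hq
  -- the cost, as a real number
  have hUreal : (U : ℝ) ≤ 8 ^ E * (Cp * (2 : ℝ) ^ (η * (φ.numVars : ℝ))) := by
    have h1 : U ≤ 8 ^ E * (φ.numVars + 1) ^ ((c + 1) * E) := by
      calc U = (2 ^ w) ^ E := hU
        _ ≤ (8 * (φ.numVars + 1) ^ (c + 1)) ^ E :=
            Nat.pow_le_pow_left (two_pow_inputWidth_encodeCNFWords_le hφ) E
        _ = 8 ^ E * (φ.numVars + 1) ^ ((c + 1) * E) := by rw [Nat.mul_pow, ← Nat.pow_mul]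
    have h2 : ((φ.numVars + 1 : ℕ) : ℝ) ^ ((c + 1) * E) ≤ Cp * (2 : ℝ) ^ (η * (φ.numVars : ℝ)) := by
      have := hCp φ.numVars; push_cast at this ⊢; exact this
    calc (U : ℝ) ≤ ((8 ^ E * (φ.numVars + 1) ^ ((c + 1) * E) : ℕ) : ℝ) := by exact_mod_cast h1
      _ = (8 : ℝ) ^ E * ((φ.numVars + 1 : ℕ) : ℝ) ^ ((c + 1) * E) := by push_cast; ring
      _ ≤ 8 ^ E * (Cp * (2 : ℝ) ^ (η * (φ.numVars : ℝ))) := mul_le_mul_of_nonneg_left h2 (by positivity)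
  have htreal : ((t : ℕ) : ℝ) ≤ Cplus * (2 : ℝ) ^ (ρ * (φ.numVars : ℝ)) + Cplus := by
    have hp : (0 : ℝ) ≤ (2 : ℝ) ^ (ρ * (φ.numVars : ℝ)) := by positivity
    have hle : C * (2 : ℝ) ^ (ρ * (φ.numVars : ℝ)) + C ≤ Cplus * (2 : ℝ) ^ (ρ * (φ.numVars : ℝ)) + Cplus :=
      add_le_add (mul_le_mul_of_nonneg_right hCC hp) hCC
    rcases lt_or_ge (C * (2 : ℝ) ^ (ρ * (φ.numVars : ℝ)) + C) 0 with hneg | hnn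
    · rw [ht, Nat.floor_of_nonpos hneg.le]; push_cast; positivity
    · rw [ht]; exact (Nat.floor_le hnn).trans hle
  have hexp : ((2 : ℝ) ^ (ρ * (φ.numVars : ℝ)) + 1) * (2 : ℝ) ^ (η * (φ.numVars : ℝ)) ≤
      2 * (2 : ℝ) ^ ((ρ + η) * (φ.numVars : ℝ)) := by
    have e1 : (2 : ℝ) ^ (ρ * (φ.numVars : ℝ)) * (2 : ℝ) ^ (η * (φ.numVars : ℝ)) = (2 : ℝ) ^ ((ρ + η) * (φ.numVars : ℝ)) := by
      rw [← Real.rpow_add (by norm_num : (0 : ℝ) < 2)]; ring_nf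
    have e2 : (2 : ℝ) ^ (η * (φ.numVars : ℝ)) ≤ (2 : ℝ) ^ ((ρ + η) * (φ.numVars : ℝ)) :=
      Real.rpow_le_rpow_of_exponent_le (by norm_num)
        (by have : (0 : ℝ) ≤ ρ * φ.numVars := by positivity
            nlinarith)
    calc ((2 : ℝ) ^ (ρ * (φ.numVars : ℝ)) + 1) * (2 : ℝ) ^ (η * (φ.numVars : ℝ))
        = (2 : ℝ) ^ (ρ * (φ.numVars : ℝ)) * (2 : ℝ) ^ (η * (φ.numVars : ℝ)) +
            (2 : ℝ) ^ (η * (φ.numVars : ℝ)) := by ring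
      _ = (2 : ℝ) ^ ((ρ + η) * (φ.numVars : ℝ)) + (2 : ℝ) ^ (η * (φ.numVars : ℝ)) := by rw [e1]
      _ ≤ (2 : ℝ) ^ ((ρ + η) * (φ.numVars : ℝ)) + (2 : ℝ) ^ ((ρ + η) * (φ.numVars : ℝ)) := by
          linarith
      _ = 2 * (2 : ℝ) ^ ((ρ + η) * (φ.numVars : ℝ)) := by ring
  have hfinal : (((t + 1) * (A * U) : ℕ) : ℝ) ≤ C' * (2 : ℝ) ^ ((ρ + η) * (φ.numVars : ℝ)) := by
    have hA0 : (0 : ℝ) ≤ (A : ℝ) := Nat.cast_nonneg _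
    have hU0 : (0 : ℝ) ≤ (U : ℝ) := Nat.cast_nonneg _
    have h2η : (0 : ℝ) ≤ (2 : ℝ) ^ (η * (φ.numVars : ℝ)) := by positivity
    have h2ρ : (0 : ℝ) ≤ (2 : ℝ) ^ (ρ * (φ.numVars : ℝ)) := by positivity
    have ht1 : ((t : ℕ) : ℝ) + 1 ≤ (Cplus + 1) * ((2 : ℝ) ^ (ρ * (φ.numVars : ℝ)) + 1) := by nlinarith
    push_cast
    calc (((t : ℕ) : ℝ) + 1) * ((A : ℝ) * (U : ℝ))
        ≤ ((Cplus + 1) * ((2 : ℝ) ^ (ρ * (φ.numVars : ℝ)) + 1)) *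
            ((A : ℝ) * (8 ^ E * (Cp * (2 : ℝ) ^ (η * (φ.numVars : ℝ))))) := by
          apply mul_le_mul ht1 (mul_le_mul_of_nonneg_left hUreal hA0) (by positivity) (by positivity)
      _ = (A : ℝ) * 8 ^ E * Cp * (Cplus + 1) *
            ((((2 : ℝ) ^ (ρ * (φ.numVars : ℝ)) + 1)) * (2 : ℝ) ^ (η * (φ.numVars : ℝ))) := by ring
      _ ≤ (A : ℝ) * 8 ^ E * Cp * (Cplus + 1) * (2 * (2 : ℝ) ^ ((ρ + η) * (φ.numVars : ℝ))) :=
          mul_le_mul_of_nonneg_left hexp (by positivity)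
      _ = C' * (2 : ℝ) ^ ((ρ + η) * (φ.numVars : ℝ)) := by rw [hC']; ring
  have hT : Inline.simCost' (encodeCNFWords φ).length (k' * w) t ((cM.queries.map (Inline.charge' (k' * w) apspOracle s)).sum)
      (readOut cM.mem).length ≤ ⌊C' * (2 : ℝ) ^ ((ρ + η) * (φ.numVars : ℝ)) + C'⌋₊ := by
    refine hcost.trans ?_
    rw [← hA]
    refine Nat.le_floor ?_
    exact hfinal.trans (le_add_of_nonneg_right hC'0)
  -- the certificate
  have hmBVB : Program.maxConst MB ≤ 2 ^ (kB * c₁ * w) + mB := by rw [hmB]; exact Nat.le_add_left _ _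
  obtain ⟨cS, hcS, houtS⟩ := Inline.haltsWithin_SIM' hdet hBdet hBof hwW hkW hL83 hmV hV1 hwsV hVQ hkBV
    hVB hmBVB hVBQ hrun' hO hMB threeSumOracle zeroCoins hT
  exact ⟨cS, hcS, by rw [houtS]; exact hgood⟩

/-- `helim` of `not_fgReducible_cnfSATWithSize_apsp_of_nseth_of_validOracleElim`, discharged. [folklore] -/
theorem validOracleElim_holds :
    ∀ (c c' : ℕ) (ρ : ℝ), 0 ≤ ρ → CNFSATInAPSPOracleRAMTimeValid c c' ρ →
      ∀ η : ℝ, 0 < η → CNFSATInThreeSumOracleRAMTime c (ρ + η) :=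
  fun _ _ _ hρ h _ hη => cnfSATInThreeSumOracleRAMTime_of_valid hρ h hη

/-- **fine-grained.S20 for APSP from the sibling's machine-model fact alone (proved).** The named
fact `sparseKSATInExpTime_of_cnfSATInThreeSumOracleRAMTime` of `NSETHNonReducibility.lean` (the
change of machine model for 3SUM-oracle programs, Cook–Reckhow 1973, §2) implies
`not_fgReducible_cnfSATWithSize_apsp_of_nseth` — every other step (the canonical APSP oracle, the
reduction as an oracle program with valid queries, the in-RAM elimination of the APSP oracle by the
simulating machine with wipes, sparsification, `k`-TAUT from `k`-SAT) is proved in the tree.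
[cite: CarmosinoEtAlITCS2016, §5 Thm. 2–3 (APSP)] -/
theorem not_fgReducible_cnfSATWithSize_apsp_of_nseth_of_threeSumBridge
    (h3 : sparseKSATInExpTime_of_cnfSATInThreeSumOracleRAMTime) :
    not_fgReducible_cnfSATWithSize_apsp_of_nseth :=
  not_fgReducible_cnfSATWithSize_apsp_of_nseth_of_validOracleElim validOracleElim_holds h3

end Literature.Computability.FineGrained
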